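import Literature.AnabelianGeometry.EtaleTheta.Discharge.Sec2Rmk2141SqTranslateCore
import Literature.AnabelianGeometry.EtaleTheta.Discharge.Sec2Remark2141NoGoModelTate
import Literature.AnabelianGeometry.EtaleTheta.Discharge.Sec1Thm110ModelTateNV
import Literature.AnabelianGeometry.EtaleTheta.Discharge.Sec2RigidityAtModelTate
import HarnessLib

/-!
# [EtTh] Remark 2.14.1 AT THE TATE DATUM OF RECORD: the shift `α_δ` of Prop. 2.14 (ii) does NOT extend to
# `Π^tp_X̲̲[μ_N]` as a cocycle shift (`N ∤ 2`, `gcd(N, l) = 1`) — proof-only; closes row «RMK2141-NOGO@modelχq»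

S. Mochizuki, *The Étale Theta Function and its Frobenioid-theoretic Manifestations* [EtTh], Publ. RIMS **45**
(2009), §2 Remark 2.14.1, PRIMS PDF p. 51 (printed p. 277): "Note that, in the notation of Proposition 2.14, (ii),
although the automorphism `α̈_δ` extends to an automorphism `α_δ` of `Π^tp_Y[μ_N]`, the automorphism `α_δ` fails to
extend to `Π^tp_X[μ_N]` [i.e., since `Ü²` fails to descend from `Y` to `X`!]; thus, it is essential to work with
homomorphisms `s^Θ_Ÿ, t^Θ_Ÿ : Π^tp_Ÿ → Π^tp_Y[μ_N]`, as opposed to composites of such homomorphisms with the natural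
inclusion `Π^tp_Y[μ_N] ↪ Π^tp_X[μ_N]`."; Prop. 2.14 (ii) p. 49 and its proof p. 50 ("the action by an element of
`Gal(Y/X)` clearly maps `Ü²` to a `K^×`-multiple of `Ü²`") (locators `p.N` = PDF pages; bib key `MochizukiEtTh2009`)
[cite: MochizukiEtTh2009, Rmk 2.14.1 p.51].  Cell `abc-iut`, layer L2 [EtTh], seat abc-iut-L2-d1 (gen 9), row
«RMK2141-NOGO@modelχq» (abc-iut-L2-lead R1137 / R1158 (4) / R1180; EtTh:Rmk2.14.1 R-b → R-a), part 2b file B — the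
target signature staged by abc-iut-w6-d076 (gen 5, `Sec2Remark2141NoGoModelTateE3Skeleton`) VERBATIM.  PROOF-ONLY
companion (no definition / instance / notation / new named fact) over: abc-iut-w6-d076's ENGINE
`ThetaEnvData.exists_coboundary_sq_translate_of_extension` (p500356); this seat's generic core
`Sec2Rmk2141SqTranslateCore` (p505388: `exists_unit_sq_translate_cocycle`, `exists_pow_of_red_sq_translate`,
`exists_mem_K_pow_eq_of_pow`); the datum of record `etaleThetaDataχqInr` with `prop15iii_etaleThetaDataχqInr`
(abc-iut-L2-t6 / Sec1Thm110ModelTateNV), `kumYdd_toKddHat_ofSection_modelχq`, `kummerCoreχq` (abc-iut-w5-d171 /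
abc-iut-L2-t6), `compat_modelχq`, `ThetaSetting.modelχq_sec2Hyps`, `aug_deckGen_pow` (p500775), `toZ_inl_gfpOf_a`;
Mathlib `PadicAlgCl.norm_extends`, `Padic.norm_eq_zpow_neg_valuation`.  Everything consumed BY NAME.

PROVED:
* `int_dvd_of_pow_eq_qdd_zpow_mul_unit` — the valuation endgame at the datum (`K = K̈ = ℚ_p`, `q̈ = p`): a unit
  `u ∈ K̄` lying in `K` with `u^N = q̈^k · w`, `w ∈ O^×_K̈`, forces `N ∣ k` (`‖u‖^N = p^{−k}`, `‖ℚ_p^×‖ = p^ℤ`).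
* **`not_exists_extension_alphaDelta_modelTate`** — for the mono-theta datum `X̲̲.thetaEnvData μ` of ANY choice `X̲̲`
  over `etaleThetaDataχqInr p`, any level `N` with `N ∤ 2` and `gcd(N, l) = 1`, any theta cocycle `η`, `x = σ₀^l`
  (`σ₀ = (a, 1)`), and any cocycle `δ` of `Π^tp_Y̲̲` whose shift carries `s^Θ_η` to `x·s^Θ_η` (Prop. 2.14 (ii)):
  there is NO cocycle `ε` of `Π^tp_X̲̲` (for `χ ∘ aug`) restricting to `δ` on `Π^tp_Y̲̲`.  Chain: engine ⇒
  `η·(x²·η) = (x·η)²·∂m` on `Π^tp_Ÿ̲̲`; core (Prop. 1.5 (iii) BY NAME, a theorem at the datum) ⇒ the second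
  difference is `infl κ̈(q̈^{−2l²}·w)` and is pointwise an `N`-th power up to a coboundary ⇒ `q̈^{−2l²}·w = u^N` with
  `u ∈ K = ℚ_p` ⇒ `N ∣ 2l²` ⇒ `N ∣ 2`, contradiction.
READING (recorded, as in the engine file): «extends to `Π^tp_X[μ_N]`» in the COCYCLE currency of the typed
Prop. 2.14 (ii) (`RigidData.Prop214_ii`); the arbitrary-automorphism reading (centraliser of `Π^tp_Y[μ_N]`) is not
typed.  The side conditions are displayed, not chosen: for `N ∣ 2` the obstruction class `κ(q̈)^{−2l²} mod N` dies
(and for `t^Θ` a mere `K^×`-conjugate `δ` is inflated from `G_K`), so print's sentence is not a `∀` over the typed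
hypotheses of Prop. 2.14 (ii) — recorded, not adjudicated.
HONEST FRAMING: `modelχq` is a SEMI-SYNTHETIC model of the typed §1 interface (the Tate-sheared χ-twisted root; not
the tempered `π₁` of a curve) — this is the kernel record of the printed computation at that inhabitant; a NO-GO at
OUR datum, not a claim beyond print's own remark; nothing of [EtTh] (refereed) is endorsed or disputed; no side is
taken on [IUTchIII] Cor. 3.12; typed ≠ proved elsewhere.
-/

noncomputable section

namespace Literature.AnabelianGeometry.EtaleTheta.SettingModel

open Literature.AnabelianGeometry.SemiGraphs _root_.Topology _root_.Function

variable (p : ℕ) [Fact p.Prime]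

/-- **The valuation endgame at the Tate datum of record** (`K = K̈ = ℚ_p`, `q̈ = p`): if a unit `u ∈ K̄` lying in
`K = ℚ_p` satisfies `u^N = q̈^k · w` with `w ∈ O^×_K̈`, then `N ∣ k` (`‖u‖^N = p^{−k}` and `‖ℚ_p^×‖ = p^ℤ`).
[cite: MochizukiEtTh2009, Rmk 2.14.1 p.51] -/
theorem int_dvd_of_pow_eq_qdd_zpow_mul_unit {N : ℕ+} {k : ℤ}
    {w : (↥(ThetaSetting.modelχq p 1 2 even_two).Kdd)ˣ} (hw : w ∈ (ThetaSetting.modelχq p 1 2 even_two).unitsOKdd)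
    {u : (PadicAlgCl p)ˣ} (huK : (u : PadicAlgCl p) ∈ (ThetaSetting.modelχq p 1 2 even_two).K)
    (hu : (u : PadicAlgCl p) ^ (N : ℕ) =
      ((((ThetaSetting.modelχq p 1 2 even_two).qddUnit ^ k * w : (↥(ThetaSetting.modelχq p 1 2 even_two).Kdd)ˣ) :
        (ThetaSetting.modelχq p 1 2 even_two).Kdd) : PadicAlgCl p)) :
    (N : ℤ) ∣ k := by
  have hp1 : 1 < (p : ℝ) := by exact_mod_cast (Fact.out : p.Prime).one_lt
  -- `u ∈ K = ℚ_p`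
  change (u : PadicAlgCl p) ∈ (⊥ : IntermediateField ℚ_[p] (PadicAlgCl p)) at huK
  rw [IntermediateField.mem_bot] at huK
  obtain ⟨y, hy⟩ := huK
  have hy0 : y ≠ 0 := by
    rintro rfl
    exact u.ne_zero (by rw [← hy, map_zero])
  -- norms: `‖u‖^N = ‖p‖^k · ‖w‖ = p^{−k}`
  have hq : ((((ThetaSetting.modelχq p 1 2 even_two).qddUnit : (↥(ThetaSetting.modelχq p 1 2 even_two).Kdd)ˣ) :
      (ThetaSetting.modelχq p 1 2 even_two).Kdd) : PadicAlgCl p) = ((p : ℚ_[p]) : PadicAlgCl p) := by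
    change ((p : ℕ) : PadicAlgCl p) = _
    rw [map_natCast]
  have hw1 : ‖(((w : (↥(ThetaSetting.modelχq p 1 2 even_two).Kdd)ˣ) : (ThetaSetting.modelχq p 1 2 even_two).Kdd) :
      PadicAlgCl p)‖ = 1 := hw
  have hnorm : ‖(u : PadicAlgCl p) ^ (N : ℕ)‖ = _ := congrArg (fun z : PadicAlgCl p => ‖z‖) hu
  rw [norm_pow, ← hy, Units.val_mul, Units.val_zpow_eq_zpow_val] at hnorm
  rw [show (((((ThetaSetting.modelχq p 1 2 even_two).qddUnit : (↥(ThetaSetting.modelχq p 1 2 even_two).Kdd)ˣ) :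
        (ThetaSetting.modelχq p 1 2 even_two).Kdd) ^ k *
        ((w : (↥(ThetaSetting.modelχq p 1 2 even_two).Kdd)ˣ) : (ThetaSetting.modelχq p 1 2 even_two).Kdd) :
        (ThetaSetting.modelχq p 1 2 even_two).Kdd) : PadicAlgCl p) =
      ((((ThetaSetting.modelχq p 1 2 even_two).qddUnit : (↥(ThetaSetting.modelχq p 1 2 even_two).Kdd)ˣ) :
        (ThetaSetting.modelχq p 1 2 even_two).Kdd) : PadicAlgCl p) ^ k *
      (((w : (↥(ThetaSetting.modelχq p 1 2 even_two).Kdd)ˣ) : (ThetaSetting.modelχq p 1 2 even_two).Kdd) :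
        PadicAlgCl p) by
      rw [IntermediateField.coe_mul]
      congr 1,
    norm_mul, norm_zpow, hw1, mul_one, hq, PadicAlgCl.norm_extends, PadicAlgCl.norm_extends, Padic.norm_p,
    Padic.norm_eq_zpow_neg_valuation hy0, ← zpow_natCast, ← zpow_mul, inv_zpow'] at hnorm
  have hexp : -y.valuation * (N : ℕ) = -k := zpow_right_injective₀ (by positivity) hp1.ne' hnorm
  exact ⟨y.valuation, by linarith⟩

variable {l : ℕ} (C : (etaleThetaDataχqInr p).DoubleUnderline l) {N : ℕ+}
  (μ : (ThetaSetting.modelχq p 1 2 even_two).CyclotomeMod l N)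

/-- **[EtTh] Remark 2.14.1 AT THE TATE DATUM OF RECORD.** For the mono-theta environment data
`T = X̲̲.thetaEnvData μ` of ANY choice `X̲̲ = C` over the étale-theta datum of record `etaleThetaDataχqInr p` (the
Tate-sheared χ-twisted root `modelχq p 1 2`, `K = K̈ = ℚ_p`, `q̈ = p`), any level `N` with `N ∤ 2` and
`gcd(N, l) = 1`, any theta cocycle `η`, and `x = σ₀^l ∈ Π^tp_X̲̲` (`σ₀ = (a, 1)` the deck generator; `x` generates
`Gal(Y̲̲/X̲̲) ≅ l·ℤ`): if the shift `α_δ` by a cocycle `δ` of `Π^tp_Y̲̲` carries `s^Θ_η` to its `Gal(Y̲̲/X̲̲)`-conjugate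
`x·s^Θ_η` (Prop. 2.14 (ii)), then `δ` does NOT extend to a cocycle of `Π^tp_X̲̲` — `α_δ` does not extend to
`Π^tp_X̲̲[μ_N]` as a cocycle shift ("`α_δ` fails to extend to `Π^tp_X[μ_N]` [i.e., since `Ü²` fails to descend from
`Y` to `X`!]", p. 51).  Proof: abc-iut-w6-d076's engine (p500356) forces `η·(x²·η) = (x·η)²·∂m` on `Π^tp_Ÿ̲̲`; by
file A the second difference is the Kummer class of `q̈^{−2l²}·w` (`w` a unit) and must then be an `N`-th power in
`K = ℚ_p`, i.e. `‖·‖`: `N ∣ 2l²`, so `N ∣ 2` — contradiction.  READING (recorded): «extends» in the COCYCLE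
currency of the typed Prop. 2.14 (ii); the side conditions `N ∤ 2`, `gcd(N,l) = 1` are displayed (for `N ∣ 2` the
obstruction dies); a NO-GO at OUR semi-synthetic datum, not a claim beyond print's remark.
[cite: MochizukiEtTh2009, Rmk 2.14.1 p.51] -/
theorem not_exists_extension_alphaDelta_modelTate (hN2 : ¬ (N : ℕ) ∣ 2) (hNl : Nat.Coprime N l)
    (x : C.Huu)
    (hx : (x : (ThetaSetting.modelχq p 1 2 even_two).PiTemp) =
      (SemidirectProduct.inl (gfpOf (FreeGroup.of 0)) : PiTpχq p 1 2) ^ l)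
    {η : (C.thetaEnvData μ (compat_modelχq p 1 2 even_two)
        (ThetaSetting.modelχq_sec2Hyps p 1 2 even_two)).PiYdd →
      (C.thetaEnvData μ (compat_modelχq p 1 2 even_two) (ThetaSetting.modelχq_sec2Hyps p 1 2 even_two)).mu}
    (hη : η ∈ (C.thetaEnvData μ (compat_modelχq p 1 2 even_two)
      (ThetaSetting.modelχq_sec2Hyps p 1 2 even_two)).thetaCocycles)
    {δ : (C.thetaEnvData μ (compat_modelχq p 1 2 even_two)
        (ThetaSetting.modelχq_sec2Hyps p 1 2 even_two)).PiY →
      (C.thetaEnvData μ (compat_modelχq p 1 2 even_two) (ThetaSetting.modelχq_sec2Hyps p 1 2 even_two)).mu}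
    (hδ : CycEnvelope.IsEnvCocycle
      (C.thetaEnvData μ (compat_modelχq p 1 2 even_two) (ThetaSetting.modelχq_sec2Hyps p 1 2 even_two)).augY
      (C.thetaEnvData μ (compat_modelχq p 1 2 even_two) (ThetaSetting.modelχq_sec2Hyps p 1 2 even_two)).chi δ)
    (hshift : ∀ g, CycEnvelope.shift hδ
        ((C.thetaEnvData μ (compat_modelχq p 1 2 even_two)
          (ThetaSetting.modelχq_sec2Hyps p 1 2 even_two)).sTheta hη g) =
      (C.thetaEnvData μ (compat_modelχq p 1 2 even_two) (ThetaSetting.modelχq_sec2Hyps p 1 2 even_two)).conjX x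
        ((C.thetaEnvData μ (compat_modelχq p 1 2 even_two)
          (ThetaSetting.modelχq_sec2Hyps p 1 2 even_two)).sTheta hη
          ⟨x⁻¹ * g * x, (C.thetaEnvData μ (compat_modelχq p 1 2 even_two)
            (ThetaSetting.modelχq_sec2Hyps p 1 2 even_two)).inv_mul_mul_mem_PiYdd x g⟩)) :
    ¬ ∃ ε : (C.thetaEnvData μ (compat_modelχq p 1 2 even_two)
          (ThetaSetting.modelχq_sec2Hyps p 1 2 even_two)).PiX →
        (C.thetaEnvData μ (compat_modelχq p 1 2 even_two) (ThetaSetting.modelχq_sec2Hyps p 1 2 even_two)).mu,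
      CycEnvelope.IsEnvCocycle
          (C.thetaEnvData μ (compat_modelχq p 1 2 even_two) (ThetaSetting.modelχq_sec2Hyps p 1 2 even_two)).aug
          (C.thetaEnvData μ (compat_modelχq p 1 2 even_two) (ThetaSetting.modelχq_sec2Hyps p 1 2 even_two)).chi ε ∧
        ∀ y : (C.thetaEnvData μ (compat_modelχq p 1 2 even_two)
          (ThetaSetting.modelχq_sec2Hyps p 1 2 even_two)).PiY, ε y = δ y := by
  rintro ⟨ε, hε, hext⟩
  -- Step 1 (abc-iut-w6-d076's engine): the second difference of the translates is a `μ_N`-coboundary on `Π^tp_Ÿ̲̲`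
  have hm := (C.thetaEnvData μ (compat_modelχq p 1 2 even_two)
    (ThetaSetting.modelχq_sec2Hyps p 1 2 even_two)).exists_coboundary_sq_translate_of_extension x hη hδ hshift hε hext
  -- `η = red ∘ f` for a root cocycle `f`; `x = σ₀^l` is geometric
  obtain ⟨f, hf, hηf⟩ := id hη
  subst hηf
  have hx1 : (ThetaSetting.modelχq p 1 2 even_two).aug.toMonoidHom
      (x : (ThetaSetting.modelχq p 1 2 even_two).PiTemp) = 1 := by
    rw [hx]
    exact aug_deckGen_pow p l
  -- Step 2 (file A): class + pointwise form of the second difference, then mod `N`, then the Kummer read-out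
  obtain ⟨w, hw, Ψ, hΨ, hΨpt⟩ := C.exists_unit_sq_translate_cocycle (compat_modelχq p 1 2 even_two)
    (prop15iii_etaleThetaDataχqInr p _) hf x hx1
  obtain ⟨e, he⟩ := C.exists_pow_of_red_sq_translate (compat_modelχq p 1 2 even_two)
    (ThetaSetting.modelχq_sec2Hyps p 1 2 even_two) μ hf x hx1 Ψ hΨpt hm
  have hΨ' : (QuotientGroup.mk Ψ : (ThetaSetting.modelχq p 1 2 even_two).H1 (ThetaSetting.modelχq p 1 2 even_two).GtpYdd) =
      (ThetaSetting.modelχq p 1 2 even_two).inflTheta (ThetaSetting.modelχq p 1 2 even_two).GtpYdd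
        ((kummerCoreχq p 1 2 even_two).toKummerData.kumYdd ((kummerCoreχq p 1 2 even_two).toKummerData.toKddHat
          ((ThetaSetting.modelχq p 1 2 even_two).qddUnit ^
              (-(2 * (Multiplicative.toAdd ((ThetaSetting.modelχq p 1 2 even_two).toZ
                  (x : (ThetaSetting.modelχq p 1 2 even_two).PiTemp)) *
                Multiplicative.toAdd ((ThetaSetting.modelχq p 1 2 even_two).toZ
                  (x : (ThetaSetting.modelχq p 1 2 even_two).PiTemp))))) * w))) := by
    rw [hΨ, ← kumYdd_toKddHat_ofSection_modelχq p 1 2 even_two SemidirectProduct.inr (continuous_inrχq p 1 2)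
      (fun _ => rfl) (inr_map_GK_le_GtpY_tate p) (inr_map_GKdd_le_GtpYdd_tate p)]
    rfl
  obtain ⟨u, huK, hu⟩ := C.exists_mem_K_pow_eq_of_pow (kummerCoreχq p 1 2 even_two) _ Ψ hΨ' e he
  -- Step 3: valuations in `K = ℚ_p`
  have hdvd := int_dvd_of_pow_eq_qdd_zpow_mul_unit p hw huK hu
  have hb : Multiplicative.toAdd ((ThetaSetting.modelχq p 1 2 even_two).toZ
      (x : (ThetaSetting.modelχq p 1 2 even_two).PiTemp)) = (l : ℤ) := by
    rw [hx, map_pow, toZ_inl_gfpOf_a, toAdd_pow, toAdd_ofAdd, nsmul_eq_mul, mul_one]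
  rw [hb, Int.dvd_neg] at hdvd
  have hdvdN : (N : ℕ) ∣ 2 * l * l := by
    have h' : ((N : ℕ) : ℤ) ∣ ((2 * l * l : ℕ) : ℤ) := by
      have e1 : ((2 * l * l : ℕ) : ℤ) = 2 * ((l : ℤ) * (l : ℤ)) := by push_cast; ring
      rw [e1]; exact hdvd
    exact Int.natCast_dvd_natCast.mp h'
  exact hN2 ((hNl.dvd_of_dvd_mul_right ((hNl.dvd_of_dvd_mul_right hdvdN))))

end Literature.AnabelianGeometry.EtaleTheta.SettingModel

end
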